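import Summits.Ventures.LatticeQCDFlow.Scaling.ReplicaExchangeBareSampler
import Summits.Ventures.LatticeQCDFlow.Scaling.ProductChainModeRestriction

/-!
HONEST FRAMING: exact (Metropolis-corrected) sampling algorithms for lattice gauge theory; figures
of merit are autocorrelation/cost numbers at stated couplings and volumes; no continuum-physics
claim.

# ReplicaExchangeBareModeBlocks — THE TAGLESS REPLICA-EXCHANGE SAMPLER DECOMPOSED WITH MODE ASSIGNMENTS AS BLOCKS:
# `π̄ = ⊗_k ν_k` (`ν_k(j) = μ_k(A_j)`), RESTRICTION POINCARÉ CONSTANT `(1 − t)γ_A/(K+1)` FROM WITHIN-MODE GAPS ONLY,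
# AND THE PROJECTION CHAIN'S FLOWS: TRANSPOSITIONS `≥ (t/K)·`(assignment-restricted swap acceptance), HOT RELABELS
# `= ((1 − t)/(K+1))·π̄(m)·M̄_0(m_0, j′)` (lean-2 GEN-18, ours)

Venture-side (OURS).  Cell `lqcd-flow` (pub-lqcd), unit `pub-lqcd-lean-2-g18`, 2026-08-25.  Chapter R, file 2:
the block structure of `P = ptBareSampler t μ M` (`Scaling/ReplicaExchangeBareSampler`) along the MODE ASSIGNMENT
`blk x = mode ∘ x : Fin (K+1) → J` of a partition `mode : S → J` of the configuration space (e.g. topological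
sectors), in the vocabulary of the Literature's decomposition theorem (`MarkovChainDecomposition`): block masses,
restriction chains (`Scaling/ProductChainModeRestriction` supplies the product structure), and the flows of the
projection chain `P̄` on assignments — exactly the two families of edges of the conveyor
(`Scaling/ConveyorPoincare`): adjacent transpositions (accepted swaps) and relabelling at the hot level `0`.

## What is proved

* §1 `sum_tensorFun_mul_apply_of_unnormalised` (one-coordinate marginal of an unnormalised product weight);
  `tensorFun_modeIndicator` (`[mode∘x = m]·π̃(x)` is a product weight); `modes_surjective`.
* §2 **`ptBareMode_blockMass`** — `π̄(m) = Π_k ν_k(m_k) = tensorFun ν m`, `ν_k(j) = μ_k(A_j)`.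
* §3 **`ptBareMode_restriction_poincare`** — every restriction chain satisfies
  `((1 − t)γ_A/(K+1))·Var ≤ 𝓔` as soon as each `M_k` restricted to each mode has Poincaré constant `γ_A`
  (the swaps only add; tensorisation over the replicas).
* §4 **`ptBareMode_blockFlow_swap_ge`** — `π̄(m)P̄(m, m∘σ_l) ≥ (t/K)·Σ_{x : mode∘x = m} min{π̃(x), π̃(x∘σ_l)}`;
  **`ptBareMode_blockFlow_relabel_ge`** — for `j′ ≠ m_0`,
  `π̄(m)P̄(m, update m 0 j′) ≥ ((1 − t)/(K+1))·π̄(m)·M̄_0(m_0, j′)` with `M̄_0 = projectionChain μ_0 M_0 mode` the mode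
  projection of the HOT update; §5 the same two bounds phrased for `(π̄, P̄)` as the hypotheses `hT`, `hR` of
  `Scaling/ConveyorPoincare.conveyor_poincare` (**`ptBareMode_proj_swap`**, **`ptBareMode_proj_relabel`**), under the
  assignment-restricted swap overlap `δ₂·min{π̄(m), π̄(m∘σ_l)} ≤ Σ_{x : mode∘x = m} min{π̃(x), π̃(x∘σ_l)}`.

NOT CLAIMED: the gap (file R3 `Scaling/ReplicaExchangeModeGap`); the reduction of the assignment-restricted overlap
to pair overlaps of adjacent levels; relabel flows at cold levels (dropped — they only help).  Literature grade (cell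
rule): KNOWN MECHANISM (decomposition of swapping chains by mode labels: Madras–Zheng 2003, Woodard–Schmidler–Huber
2009, Bhatnagar–Randall 2016), NEW TYPING; nothing cited as a fact; no new bib keys.
-/

noncomputable section

open Finset Function
open Literature.Probability.MarkovChains
open Literature.Probability.MarkovChains.Decomposition

namespace Summit.Ventures.LatticeQCDFlow.Scaling

variable {S J : Type*} [Fintype S] [DecidableEq S] [DecidableEq J] {K : ℕ}
  {μ : Fin (K + 1) → S → ℝ} {M : Fin (K + 1) → S → S → ℝ} {mode : S → J} {t : ℝ}

/-! ## §1 Product-weight tools -/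

omit [DecidableEq S] [DecidableEq J] in
/-- **One-coordinate marginal of an unnormalised product weight:**
`Σ_x (⊗φ)(x)·h(x_i) = (Σ_u φ_i(u)h(u))·Π_{k ≠ i} Σ_u φ_k(u)`. [ours] -/
theorem sum_tensorFun_mul_apply_of_unnormalised (φ : Fin (K + 1) → S → ℝ) (i : Fin (K + 1)) (h : S → ℝ) :
    ∑ x : Fin (K + 1) → S, tensorFun φ x * h (x i)
      = (∑ u, φ i u * h u) * ∏ k ∈ univ \ {i}, ∑ u, φ k u := by
  set φ' : Fin (K + 1) → S → ℝ := update φ i (fun u => φ i u * h u) with hφ'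
  have hupd : ∀ x : Fin (K + 1) → S, tensorFun φ x * h (x i) = tensorFun φ' x := by
    intro x
    have hf : ∀ k, φ' k (x k) = update (fun k => φ k (x k)) i (φ i (x i) * h (x i)) k := by
      intro k
      by_cases hki : k = i
      · subst hki; rw [hφ', update_self, update_self]
      · rw [hφ', update_of_ne hki, update_of_ne hki]
    unfold tensorFun
    rw [prod_congr rfl fun k _ => hf k, prod_update_of_mem (mem_univ i),
      prod_eq_mul_prod_sdiff_singleton_of_mem (mem_univ i) (fun k => φ k (x k))]
    ring
  simp_rw [hupd]
  rw [sum_tensorFun, prod_eq_mul_prod_sdiff_singleton_of_mem (mem_univ i)]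
  congr 1
  · rw [hφ', update_self]
  · refine prod_congr rfl fun k hk => ?_
    have hki : k ≠ i := by rw [mem_sdiff, mem_singleton] at hk; exact hk.2
    rw [hφ', update_of_ne hki]

omit [Fintype S] [DecidableEq S] in
/-- **The indicator of an assignment block times the product law is a product weight:**
`[mode∘x = m]·π̃(x) = ⊗_k([mode u = m_k]·μ_k(u))(x)`. [ours] -/
theorem tensorFun_modeIndicator (m : Fin (K + 1) → J) (x : Fin (K + 1) → S) :
    (if mode ∘ x = m then tensorFun μ x else 0)
      = tensorFun (fun k u => if mode u = m k then μ k u else 0) x := by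
  by_cases hx : mode ∘ x = m
  · rw [if_pos hx]
    unfold tensorFun
    refine prod_congr rfl fun k _ => ?_
    have : mode (x k) = m k := congrFun hx k
    simp [this]
  · rw [if_neg hx]
    have : ∃ k, mode (x k) ≠ m k := by
      by_contra hall
      push Not at hall
      exact hx (funext hall)
    obtain ⟨k, hk⟩ := this
    unfold tensorFun
    exact (prod_eq_zero (mem_univ k) (by simp [hk])).symm

omit [Fintype S] [DecidableEq S] [DecidableEq J] in
/-- Assignments are attained when the modes are. [ours] -/
theorem modes_surjective (hmode : Function.Surjective mode) :
    Function.Surjective (fun z : Fin (K + 1) → S => mode ∘ z) := by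
  intro m
  refine ⟨fun k => (hmode (m k)).choose, funext fun k => ?_⟩
  simp only [Function.comp_apply]
  exact (hmode (m k)).choose_spec

/-! ## §2 Block masses -/

omit [DecidableEq S] in
/-- **`π̄(m) = Π_k μ_k(A_{m_k})`: the law of the assignment is the product of the mode masses.** [ours] -/
theorem ptBareMode_blockMass (m : Fin (K + 1) → J) :
    blockMass (tensorFun μ) (fun z : Fin (K + 1) → S => mode ∘ z) m
      = tensorFun (fun k => blockMass (μ k) mode) m := by
  rw [blockMass_tensorFun_modes]; rfl

omit [DecidableEq S] in
/-- Every assignment has positive mass (`μ_k > 0`, `mode` onto). [ours] -/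
theorem ptBareMode_blockMass_pos (hμ : ∀ k x, 0 < μ k x) (hmode : Function.Surjective mode)
    (m : Fin (K + 1) → J) : 0 < blockMass (tensorFun μ) (fun z : Fin (K + 1) → S => mode ∘ z) m :=
  blockMass_pos (tensorFun_pos hμ) (modes_surjective hmode) m

/-! ## §3 The restriction chains: within-mode gaps only -/

/-- **The restriction chain of an assignment contains the product of the mode-restricted updates, slowed by
`1 − t`:** its Dirichlet form dominates `(1 − t)·` that of the restriction of `prodKernel` (swaps only add). [ours] -/
theorem ptBareMode_dirichletForm_restriction_ge (hμ : ∀ k x, 0 < μ k x) (ht0 : 0 ≤ t)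
    (m : Fin (K + 1) → J) (f : (Fin (K + 1) → S) → ℝ) :
    (1 - t) * dirichletForm (blockLaw (tensorFun μ) (fun z : Fin (K + 1) → S => mode ∘ z) m)
        (restrictionChain (prodKernel (fun _ : Fin (K + 1) => (1 : ℝ) / (K + 1)) M)
          (fun z : Fin (K + 1) → S => mode ∘ z)) f
      ≤ dirichletForm (blockLaw (tensorFun μ) (fun z : Fin (K + 1) → S => mode ∘ z) m)
          (restrictionChain (ptBareSampler t μ M) (fun z : Fin (K + 1) → S => mode ∘ z)) f := by
  unfold dirichletForm
  rw [← mul_assoc, mul_comm (1 - t), mul_assoc, mul_sum]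
  refine mul_le_mul_of_nonneg_left (sum_le_sum fun x _ => ?_) (by norm_num)
  rw [mul_sum]
  refine sum_le_sum fun y _ => ?_
  have hL : 0 ≤ blockLaw (tensorFun μ) (fun z : Fin (K + 1) → S => mode ∘ z) m x :=
    blockLaw_nonneg (fun z => (tensorFun_pos hμ z).le) _ m x
  rw [mul_assoc, mul_assoc, restrictionChain_mul_sq_sub, restrictionChain_mul_sq_sub, ← mul_assoc, ← mul_assoc,
    mul_comm (1 - t), mul_assoc, mul_assoc]
  refine mul_le_mul_of_nonneg_left ?_ hL
  split_ifs with hb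
  · rw [← mul_assoc]
    exact mul_le_mul_of_nonneg_right (ptBareSampler_ge_update hμ ht0 x y) (sq_nonneg _)
  · simp

/-- **THE RESTRICTION POINCARÉ CONSTANT `(1 − t)γ_A/(K+1)`:** if every within-level update restricted to every mode
satisfies `γ_A·Var ≤ 𝓔`, then for every assignment `m` and every `f`,
`((1 − t)γ_A/(K+1))·Var_{π̃(·|m)}(f) ≤ 𝓔_{π̃(·|m)}(P_m; f)` — no global within-level gap enters (`0 ≤ t ≤ 1`). [ours] -/
theorem ptBareMode_restriction_poincare (hμ : ∀ k x, 0 < μ k x) (hmode : Function.Surjective mode)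
    (hM : ∀ k, IsRowStochastic (M k)) (ht0 : 0 ≤ t) (ht1 : t ≤ 1) {γA : ℝ}
    (hgapA : ∀ k j, ∀ h : S → ℝ, γA * lawVariance (blockLaw (μ k) mode j) h
      ≤ dirichletForm (blockLaw (μ k) mode j) (restrictionChain (M k) mode) h)
    (m : Fin (K + 1) → J) (f : (Fin (K + 1) → S) → ℝ) :
    (1 - t) * γA / (K + 1) * lawVariance (blockLaw (tensorFun μ) (fun z : Fin (K + 1) → S => mode ∘ z) m) f
      ≤ dirichletForm (blockLaw (tensorFun μ) (fun z : Fin (K + 1) → S => mode ∘ z) m)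
          (restrictionChain (ptBareSampler t μ M) (fun z : Fin (K + 1) → S => mode ∘ z)) f := by
  have h1 := prodKernel_restriction_poincare_uniform (M := M) hμ hmode hM hgapA m f
  have h2 := ptBareMode_dirichletForm_restriction_ge (M := M) (mode := mode) hμ ht0 m f
  calc (1 - t) * γA / (K + 1) * lawVariance (blockLaw (tensorFun μ) (fun z : Fin (K + 1) → S => mode ∘ z) m) f
      = (1 - t) * (γA / (K + 1)
          * lawVariance (blockLaw (tensorFun μ) (fun z : Fin (K + 1) → S => mode ∘ z) m) f) := by ring
    _ ≤ (1 - t) * dirichletForm (blockLaw (tensorFun μ) (fun z : Fin (K + 1) → S => mode ∘ z) m)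
          (restrictionChain (prodKernel (fun _ : Fin (K + 1) => (1 : ℝ) / (K + 1)) M)
            (fun z : Fin (K + 1) → S => mode ∘ z)) f := mul_le_mul_of_nonneg_left h1 (by linarith)
    _ ≤ _ := h2

/-! ## §4 The projection chain's flows -/

omit [Fintype S] [DecidableEq S] [DecidableEq J] in
/-- A swap carries an assignment block to the swapped assignment block. [ours] -/
theorem modes_comp_levelSwap (x : Fin (K + 1) → S) (l : Fin K) :
    mode ∘ (x ∘ levelSwap l) = (mode ∘ x) ∘ levelSwap l := rfl

/-- **Transposition flows:** `π̄(m)P̄(m, m∘σ_l) ≥ (t/K)·Σ_{x : mode∘x = m} min{π̃(x), π̃(x∘σ_l)}` (`0 ≤ t ≤ 1`). [ours] -/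
theorem ptBareMode_blockFlow_swap_ge (hμ : ∀ k x, 0 < μ k x) (hM : ∀ k, IsRowStochastic (M k)) (ht0 : 0 ≤ t)
    (ht1 : t ≤ 1) (m : Fin (K + 1) → J) (l : Fin K) :
    t / K * ∑ x ∈ block (fun z : Fin (K + 1) → S => mode ∘ z) m, min (tensorFun μ x) (tensorFun μ (x ∘ levelSwap l))
      ≤ blockFlow (tensorFun μ) (ptBareSampler t μ M) (fun z : Fin (K + 1) → S => mode ∘ z) m (m ∘ levelSwap l) := by
  unfold blockFlow
  rw [mul_sum]
  refine sum_le_sum fun x hx => ?_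
  have hxm : mode ∘ x = m := mem_block.mp hx
  have hy : x ∘ levelSwap l ∈ block (fun z : Fin (K + 1) → S => mode ∘ z) (m ∘ levelSwap l) := by
    rw [mem_block, modes_comp_levelSwap, hxm]
  calc t / K * min (tensorFun μ x) (tensorFun μ (x ∘ levelSwap l))
      ≤ tensorFun μ x * ptBareSampler t μ M x (x ∘ levelSwap l) :=
        tensorFun_mul_ptBareSampler_swap_ge hμ hM ht0 ht1 x l
    _ ≤ ∑ y ∈ block (fun z : Fin (K + 1) → S => mode ∘ z) (m ∘ levelSwap l), tensorFun μ x * ptBareSampler t μ M x y :=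
        single_le_sum (f := fun y => tensorFun μ x * ptBareSampler t μ M x y)
          (fun y _ => mul_nonneg (tensorFun_pos hμ x).le (ptBareSampler_nonneg hμ hM ht0 ht1 x y)) hy

/-- **Hot-relabel flows:** for `j′ ≠ m_0`,
`π̄(m)P̄(m, update m 0 j′) ≥ ((1 − t)/(K+1))·π̄(m)·M̄_0(m_0, j′)`, `M̄_0 = projectionChain μ_0 M_0 mode` the mode
projection of the hot update, `π̄ = tensorFun ν`, `ν_k(j) = μ_k(A_j)`. [ours] -/
theorem ptBareMode_blockFlow_relabel_ge (hμ : ∀ k x, 0 < μ k x) (hmode : Function.Surjective mode)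
    (hM : ∀ k, IsRowStochastic (M k)) (ht0 : 0 ≤ t) (ht1 : t ≤ 1) (m : Fin (K + 1) → J) {j' : J}
    (hj : j' ≠ m 0) :
    (1 - t) / (K + 1) * (tensorFun (fun k => blockMass (μ k) mode) m
        * projectionChain (μ 0) (M 0) mode (m 0) j')
      ≤ blockFlow (tensorFun μ) (ptBareSampler t μ M) (fun z : Fin (K + 1) → S => mode ∘ z) m (update m 0 j') := by
  set ν : Fin (K + 1) → J → ℝ := fun k => blockMass (μ k) mode with hν
  set g : S → ℝ := fun a => ∑ b ∈ block mode j', M 0 a b with hg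
  -- Step 1: keep only the one-coordinate moves at the hot level into `A_{j'}`
  have S1 : (1 - t) / (K + 1) * ∑ x ∈ block (fun z : Fin (K + 1) → S => mode ∘ z) m, tensorFun μ x * g (x 0)
      ≤ blockFlow (tensorFun μ) (ptBareSampler t μ M) (fun z : Fin (K + 1) → S => mode ∘ z) m (update m 0 j') := by
    unfold blockFlow
    rw [mul_sum]
    refine sum_le_sum fun x hx => ?_
    have hxm : mode ∘ x = m := mem_block.mp hx
    have hinj : Set.InjOn (fun b : S => update x 0 b) ↑(block mode j') := fun b _ b' _ h => update_injective x 0 h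
    have himg : (block mode j').image (fun b : S => update x 0 b)
        ⊆ block (fun z : Fin (K + 1) → S => mode ∘ z) (update m 0 j') := by
      intro y hy
      rw [mem_image] at hy
      obtain ⟨b, hb, rfl⟩ := hy
      rw [mem_block]
      change mode ∘ update x 0 b = update m 0 j'
      rw [comp_update, hxm, mem_block.mp hb]
    calc (1 - t) / (K + 1) * (tensorFun μ x * g (x 0))
        = ∑ b ∈ block mode j', (1 - t) / (K + 1) * (tensorFun μ x * M 0 (x 0) b) := by
          rw [hg, mul_sum, mul_sum]
      _ ≤ ∑ b ∈ block mode j', tensorFun μ x * ptBareSampler t μ M x (update x 0 b) := by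
          refine sum_le_sum fun b hb => tensorFun_mul_ptBareSampler_update_ge hμ ht0 x 0 ?_
          intro e
          apply hj
          have h1 : mode b = j' := mem_block.mp hb
          have h2 : mode (x 0) = m 0 := congrFun hxm 0
          rw [← h1, e, h2]
      _ = ∑ y ∈ (block mode j').image (fun b : S => update x 0 b), tensorFun μ x * ptBareSampler t μ M x y :=
          (sum_image (f := fun y => tensorFun μ x * ptBareSampler t μ M x y) hinj).symm
      _ ≤ ∑ y ∈ block (fun z : Fin (K + 1) → S => mode ∘ z) (update m 0 j'), tensorFun μ x * ptBareSampler t μ M x y :=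
          sum_le_sum_of_subset_of_nonneg himg fun y _ _ =>
            mul_nonneg (tensorFun_pos hμ x).le (ptBareSampler_nonneg hμ hM ht0 ht1 x y)
  -- Step 2: the block-restricted one-coordinate marginal
  have S2 : ∑ x ∈ block (fun z : Fin (K + 1) → S => mode ∘ z) m, tensorFun μ x * g (x 0)
      = (∑ a ∈ block mode (m 0), μ 0 a * g a) * ∏ k ∈ univ \ {0}, ν k (m k) := by
    have e1 : ∑ x ∈ block (fun z : Fin (K + 1) → S => mode ∘ z) m, tensorFun μ x * g (x 0)
        = ∑ x : Fin (K + 1) → S, tensorFun (fun k u => if mode u = m k then μ k u else 0) x * g (x 0) := by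
      unfold block
      rw [sum_filter]
      refine sum_congr rfl fun x _ => ?_
      rw [← tensorFun_modeIndicator m x]
      split_ifs <;> simp
    rw [e1, sum_tensorFun_mul_apply_of_unnormalised]
    congr 1
    · unfold block
      rw [sum_filter]
      refine sum_congr rfl fun a _ => ?_
      split_ifs <;> simp
    · refine prod_congr rfl fun k _ => ?_
      simp only [hν]
      unfold blockMass block
      rw [sum_filter]
  -- Step 3: identify the hot factor with the mode projection of `M_0`
  have hν0 : ν 0 (m 0) ≠ 0 := (blockMass_pos (hμ 0) hmode (m 0)).ne'
  have S3 : ∑ a ∈ block mode (m 0), μ 0 a * g a = ν 0 (m 0) * projectionChain (μ 0) (M 0) mode (m 0) j' := by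
    rw [blockMass_mul_projectionChain hν0]
    unfold blockFlow
    simp only [hg, mul_sum]
  have S4 : tensorFun ν m = ν 0 (m 0) * ∏ k ∈ univ \ {0}, ν k (m k) := tensorFun_eq_mul_prod ν m 0
  calc (1 - t) / (K + 1) * (tensorFun ν m * projectionChain (μ 0) (M 0) mode (m 0) j')
      = (1 - t) / (K + 1) * ((ν 0 (m 0) * projectionChain (μ 0) (M 0) mode (m 0) j')
          * ∏ k ∈ univ \ {0}, ν k (m k)) := by rw [S4]; ring
    _ = (1 - t) / (K + 1) * ∑ x ∈ block (fun z : Fin (K + 1) → S => mode ∘ z) m, tensorFun μ x * g (x 0) := by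
        rw [S2, S3]
    _ ≤ _ := S1

/-! ## §5 The conveyor hypotheses for `(π̄, P̄)` -/

/-- **Hypothesis `hT` of `conveyor_poincare` for the projection chain:** under the assignment-restricted swap overlap
`δ₂·min{π̄(m), π̄(m∘σ_l)} ≤ Σ_{x : mode∘x = m} min{π̃(x), π̃(x∘σ_l)}`,
`(tδ₂/K)·min{π̄(m), π̄(m∘σ_l)} ≤ π̄(m)·P̄(m, m∘σ_l)`. [ours] -/
theorem ptBareMode_proj_swap (hμ : ∀ k x, 0 < μ k x) (hmode : Function.Surjective mode)
    (hM : ∀ k, IsRowStochastic (M k)) (ht0 : 0 ≤ t) (ht1 : t ≤ 1) {δ₂ : ℝ}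
    (hδ : ∀ (m : Fin (K + 1) → J) (l : Fin K), m ∘ levelSwap l ≠ m →
      δ₂ * min (blockMass (tensorFun μ) (fun z : Fin (K + 1) → S => mode ∘ z) m)
          (blockMass (tensorFun μ) (fun z : Fin (K + 1) → S => mode ∘ z) (m ∘ levelSwap l))
        ≤ ∑ x ∈ block (fun z : Fin (K + 1) → S => mode ∘ z) m, min (tensorFun μ x) (tensorFun μ (x ∘ levelSwap l)))
    (m : Fin (K + 1) → J) (l : Fin K) (hml : m ∘ Equiv.swap l.castSucc l.succ ≠ m) :
    t * δ₂ / K * min (blockMass (tensorFun μ) (fun z : Fin (K + 1) → S => mode ∘ z) m)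
        (blockMass (tensorFun μ) (fun z : Fin (K + 1) → S => mode ∘ z) (m ∘ Equiv.swap l.castSucc l.succ))
      ≤ blockMass (tensorFun μ) (fun z : Fin (K + 1) → S => mode ∘ z) m
          * projectionChain (tensorFun μ) (ptBareSampler t μ M) (fun z : Fin (K + 1) → S => mode ∘ z) m
              (m ∘ Equiv.swap l.castSucc l.succ) := by
  have hlv : (Equiv.swap l.castSucc l.succ : Fin (K + 1) → Fin (K + 1)) = levelSwap l := rfl
  rw [hlv, blockMass_mul_projectionChain (ptBareMode_blockMass_pos hμ hmode m).ne']
  calc t * δ₂ / K * min (blockMass (tensorFun μ) (fun z : Fin (K + 1) → S => mode ∘ z) m)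
        (blockMass (tensorFun μ) (fun z : Fin (K + 1) → S => mode ∘ z) (m ∘ levelSwap l))
      = t / K * (δ₂ * min (blockMass (tensorFun μ) (fun z : Fin (K + 1) → S => mode ∘ z) m)
          (blockMass (tensorFun μ) (fun z : Fin (K + 1) → S => mode ∘ z) (m ∘ levelSwap l))) := by ring
    _ ≤ t / K * ∑ x ∈ block (fun z : Fin (K + 1) → S => mode ∘ z) m,
          min (tensorFun μ x) (tensorFun μ (x ∘ levelSwap l)) :=
        mul_le_mul_of_nonneg_left (hδ m l hml) (by positivity)
    _ ≤ _ := ptBareMode_blockFlow_swap_ge hμ hM ht0 ht1 m l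

/-- **Hypothesis `hR` of `conveyor_poincare` for the projection chain:** for `j′ ≠ m_0`,
`((1 − t)/(K+1))·(π̄(m)·M̄_0(m_0, j′)) ≤ π̄(m)·P̄(m, update m 0 j′)` with `π̄ = tensorFun ν`. [ours] -/
theorem ptBareMode_proj_relabel (hμ : ∀ k x, 0 < μ k x) (hmode : Function.Surjective mode)
    (hM : ∀ k, IsRowStochastic (M k)) (ht0 : 0 ≤ t) (ht1 : t ≤ 1) (m : Fin (K + 1) → J) (j' : J)
    (hj : j' ≠ m 0) :
    (1 - t) / (K + 1) * (tensorFun (fun k => blockMass (μ k) mode) m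
        * projectionChain (μ 0) (M 0) mode (m 0) j')
      ≤ tensorFun (fun k => blockMass (μ k) mode) m
          * projectionChain (tensorFun μ) (ptBareSampler t μ M) (fun z : Fin (K + 1) → S => mode ∘ z) m
              (update m 0 j') := by
  rw [← ptBareMode_blockMass m, blockMass_mul_projectionChain (ptBareMode_blockMass_pos hμ hmode m).ne',
    ptBareMode_blockMass m]
  exact ptBareMode_blockFlow_relabel_ge hμ hmode hM ht0 ht1 m hj

end Summit.Ventures.LatticeQCDFlow.Scaling
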